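import Mathlib
import HarnessLib
import Literature.Analysis.FluidPDE.VorticityCalculus
import Summits.NavierStokesRegularity.NavierStokesRegularity.Theses.LoopPeriodRatchet
import Summits.NavierStokesRegularity.NavierStokesRegularity.Theorems.LiouvilleConjectureNS
import Summits.NavierStokesRegularity.NavierStokesRegularity.Theorems.LoopPeriodRatchetNoLoopsOfGrowth
import Summits.NavierStokesRegularity.NavierStokesRegularity.Theorems.LoopPeriodRatchetNoLoopsOfRatchet
import Summits.NavierStokesRegularity.NavierStokesRegularity.Theorems.LoopPeriodRatchetPeriodScalingBound
import Summits.NavierStokesRegularity.NavierStokesRegularity.Theorems.PoloidalWindowDoorPoloidalWindowRigidityWindow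
import Summits.NavierStokesRegularity.NavierStokesRegularity.Theorems.SqueezeCycleExtremalBiaxialitySubcriticalOfLiouville
import Summits.NavierStokesRegularity.NavierStokesRegularity.Theorems.PoloidalWindowDoorPoloidalWindowRigidityHotLoopsPeakless

/-!
# Crux `FrequencyGrowthExponent` (stmt-NavierStokesRegularity-27893), negative side: the refutation criterion and
# what a refutation would refute

Negative-side (cdisprove, D-0016) support lemmas for the wall `LoopPeriodRatchet.FrequencyGrowthExponent` (rank 2, the
shared item S6G of the K2 thread-axis / hot_loops lines), so that ideators / planners / provers can IMPORT them.
Nothing here closes or changes any item (`--supports`).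

* `IsVortexLoop v t c T` — the four clauses «`c` is a non-stationary closed vortex line of the frozen slice `v t` with a
  period `T > 0`» exactly as they occur in the crux; `HasClassLoop` — SOME e₃-poloidal Type-I Oseen-mild ancient
  profile (the crux's five binders, verbatim) carries such a loop at SOME negative time.  This is the object `W` of the
  negation-first reading (req192): the whole adversarial content of the item.
* `frequencyGrowthExponent_false_of_hasClassLoop` — **`W → ¬ FrequencyGrowthExponent`**: a loop anywhere kills the wall,
  because the wall and the PROVED floor `PeriodScalingBound` forbid loops outright (the PROVED engine `NoLoopsOfGrowth`).
* `not_frequencyGrowthExponent_iff` — **the refutation criterion `¬ FrequencyGrowthExponent ↔ HasClassLoop`**: the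
  converse direction is vacuity (no loop in the class ⇒ the crux's loop hypothesis is never met; `A = 1`, `κ = 0`).
  So the growth exponent `κ < 3/2`, the constant `A` and the backward-persistence clause are LOGICALLY INERT given the
  floor: the item is exactly the loop-free Liouville-type statement «no profile of the class carries a vortex loop».
* `not_periodRatchet_iff` — the same criterion for the rev-1 aside `PeriodRatchet` (κ = 0; via the PROVED
  `NoLoopsOfRatchet`); hence `frequencyGrowthExponent_iff_periodRatchet`: the «certified weakening» is an equivalence.
* `not_liouvilleConjectureNS_of_hasClassLoop`, `not_liouvilleConjectureNS_of_not_frequencyGrowthExponent` — **the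
  adversary's bar**: a witness `W` is, after a time shift, a non-constant bounded ancient mild solution, i.e. a
  counterexample to the Liouville conjecture (L) of Koch–Nadirashvili–Seregin–Šverák (by Albritton–Barker 2019,
  Thm 1.1, equivalently a Type-I singularity); equivalently (L) implies the wall.  No explicit member of the poloidal
  Type-I ancient class other than `0` is known (the axisymmetric swirl-free and the unidirectional strata are `{0}`).
* `frequencyGrowthExponent_false_of_hasClassPlanarPeak` — the hot_loops form of `W`: a profile of the class whose
  vertical velocity has a STRICT LOCAL EXTREMUM on one horizontal plane at one time kills the wall
  (`…HotLoopsPeakless.zero_of_strictPlanarExtremum`, landed, conditional on the wall; a strict planar extremum is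
  incompatible with `v ≡ 0` because the punctured plane accumulates at the point); and, through the criterion, such a
  profile forces a (possibly different) loop-carrying profile: `hasClassLoop_of_hasClassPlanarPeak`.

HONEST FRAMING: conditional bookkeeping about an OPEN item of a DOOR route (rung N0-LocalTubeDoorPoloidal); no
statement here bears on `PoloidalWindowDoor.Target` or on Navier–Stokes regularity, and `HasClassLoop` is NOT
claimed — it is the construction target whose inhabitation would refute the wall (and (L)).
-/

noncomputable section

-- the summit and its single sub-problem share the name (CONVENTIONS §1), as in every Theorems file
set_option linter.dupNamespace false

namespace Summit.NavierStokesRegularity.NavierStokesRegularity.Theorems.FrequencyGrowthExponent.Negative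

open Set Function Filter Topology Metric
open scoped RealInnerProductSpace InnerProductSpace
open Summit.NavierStokesRegularity.NavierStokesRegularity.Theses.LoopPeriodRatchet
open Summit.NavierStokesRegularity.NavierStokesRegularity.Theorems.LoopPeriodRatchetNoLoopsOfGrowth
open Summit.NavierStokesRegularity.NavierStokesRegularity.Theorems.LoopPeriodRatchetNoLoopsOfRatchet
open Summit.NavierStokesRegularity.NavierStokesRegularity.Theorems.LoopPeriodRatchetPeriodScalingBound
open Summit.NavierStokesRegularity.NavierStokesRegularity.Theorems.PoloidalWindowDoorPoloidalWindowRigidityWindow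
open Summit.NavierStokesRegularity.NavierStokesRegularity.Theorems.PoloidalWindowDoorPoloidalWindowRigidityHotLoopsPeakless

/-! ## The objects -/

/-- **A closed vortex line carrying vorticity** of the frozen slice `v t`: `c : ℝ → ℝ³` has a period `T > 0`, solves
`c′(s) = curl v(t)(c(s))` for all `s`, and is not stationary (the four clauses of the crux, verbatim). -/
def IsVortexLoop (v : ℝ → EuclideanSpace ℝ (Fin 3) → EuclideanSpace ℝ (Fin 3)) (t : ℝ)
    (c : ℝ → EuclideanSpace ℝ (Fin 3)) (T : ℝ) : Prop :=
  0 < T ∧ Function.Periodic c T ∧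
    (∀ s, HasDerivAt c (Literature.Analysis.FluidPDE.curl (v t) (c s)) s) ∧
    (∃ s, Literature.Analysis.FluidPDE.curl (v t) (c s) ≠ 0)

/-- **`W` — the class carries a loop**: some e₃-poloidal Type-I Oseen-mild ancient profile (Type-I rate `C/√(−t)`,
continuous on the open past slab, unit-viscosity Oseen–Duhamel mild between all pairs of negative times,
divergence free, `⟪curl v(s), e₃⟫ ≡ 0`; the crux's binders verbatim) has a non-stationary closed vortex line at
some time `t < 0`.  OPEN (a witness is a non-constant bounded ancient mild solution, see
`not_liouvilleConjectureNS_of_hasClassLoop`); this is the construction target of the negation-first reading. -/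
def HasClassLoop : Prop :=
  ∃ (C : ℝ) (v : ℝ → EuclideanSpace ℝ (Fin 3) → EuclideanSpace ℝ (Fin 3)),
    Literature.Analysis.FluidPDE.HasTypeITimeDecay C v ∧
    ContinuousOn (Function.uncurry v) (Set.Iio (0 : ℝ) ×ˢ Set.univ) ∧
    (∀ s t : ℝ, s < t → t < 0 → ∀ x, v t x =
      Literature.Analysis.UnboundedOperators.heatExtension (v s) (t - s) x -
        Literature.Analysis.FluidPDE.oseenDuhamel 1 s v v t x) ∧
    (∀ t < 0, Literature.Analysis.FluidPDE.VectorCalculus.IsDivFree (v t)) ∧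
    (∀ s < 0, ∀ y, ⟪Literature.Analysis.FluidPDE.curl (v s) y, EuclideanSpace.single 2 1⟫_ℝ = 0) ∧
    ∃ t : ℝ, t < 0 ∧ ∃ (c : ℝ → EuclideanSpace ℝ (Fin 3)) (T : ℝ), IsVortexLoop v t c T

/-- **`W′` — the class carries a planar peak of the vertical velocity**: some profile of the class has, at some time
`s < 0` and some point `y`, a STRICT local maximum of `σ·v₃(s,·)` (`σ = ±1`) restricted to the horizontal plane through
`y` (stated with the punctured planar neighbourhood filter, as in `…HotLoopsPeakless.zero_of_strictPlanarExtremum` and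
`LoopPeriodRatchet.PlanarExtremumLiouville`).  OPEN; the hot_loops form of the construction target. -/
def HasClassPlanarPeak : Prop :=
  ∃ (C : ℝ) (v : ℝ → EuclideanSpace ℝ (Fin 3) → EuclideanSpace ℝ (Fin 3)),
    Literature.Analysis.FluidPDE.HasTypeITimeDecay C v ∧
    ContinuousOn (Function.uncurry v) (Set.Iio (0 : ℝ) ×ˢ Set.univ) ∧
    (∀ s t : ℝ, s < t → t < 0 → ∀ x, v t x =
      Literature.Analysis.UnboundedOperators.heatExtension (v s) (t - s) x -
        Literature.Analysis.FluidPDE.oseenDuhamel 1 s v v t x) ∧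
    (∀ t < 0, Literature.Analysis.FluidPDE.VectorCalculus.IsDivFree (v t)) ∧
    (∀ s < 0, ∀ y, ⟪Literature.Analysis.FluidPDE.curl (v s) y, EuclideanSpace.single 2 1⟫_ℝ = 0) ∧
    ∃ (s σ : ℝ) (y : EuclideanSpace ℝ (Fin 3)), s < 0 ∧ (σ = 1 ∨ σ = -1) ∧
      ∀ᶠ y' in nhdsWithin y {y' | y' 2 = y 2 ∧ y' ≠ y}, σ * v s y' 2 < σ * v s y 2

/-! ## Loops: the refutation criterion -/

/-- Re-basing a loop at a non-stationary point: from the crux's loop data one gets the orbit data of the support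
items (`γ(θ + T) = γ θ`, `curl v(t)(γ 0) ≠ 0`). -/
theorem exists_rebased_of_isVortexLoop {v : ℝ → EuclideanSpace ℝ (Fin 3) → EuclideanSpace ℝ (Fin 3)} {t : ℝ}
    {c : ℝ → EuclideanSpace ℝ (Fin 3)} {T : ℝ} (h : IsVortexLoop v t c T) :
    ∃ γ : ℝ → EuclideanSpace ℝ (Fin 3), 0 < T ∧
      (∀ θ, HasDerivAt γ (Literature.Analysis.FluidPDE.curl (v t) (γ θ)) θ) ∧
      (∀ θ, γ (θ + T) = γ θ) ∧ Literature.Analysis.FluidPDE.curl (v t) (γ 0) ≠ 0 := by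
  obtain ⟨hT, hper, hder, s₀, hs₀⟩ := h
  refine ⟨fun θ => c (θ + s₀), hT, fun θ => HasDerivAt.comp_add_const θ s₀ (hder (θ + s₀)), fun θ => ?_, by simpa using hs₀⟩
  simp only
  rw [show θ + T + s₀ = θ + s₀ + T by ring, hper]

/-- **`W → ¬ FrequencyGrowthExponent`.**  The wall together with the PROVED floor `PeriodScalingBound`
(`periodScalingBound_proof`) forbids every closed vortex line carrying vorticity in the class (the PROVED engine
`noLoopsOfGrowth_proof`); so one loop anywhere refutes the wall. -/
theorem frequencyGrowthExponent_false_of_hasClassLoop (hW : HasClassLoop) : ¬ FrequencyGrowthExponent := by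
  intro hG
  obtain ⟨C, v, hrate, hcont, hmild, hdiv, hpol, t, ht, c, T, hloop⟩ := hW
  obtain ⟨γ, hT, hγ, hper, hne⟩ := exists_rebased_of_isVortexLoop hloop
  exact hne (noLoopsOfGrowth_proof hG periodScalingBound_proof C v hrate hcont hmild hdiv hpol t ht γ T hT hγ hper)

/-- **Vacuity converse.**  If NO profile of the class carries a loop, the wall holds with `A = 1`, `κ = 0`: its loop
hypothesis is never met. -/
theorem hasClassLoop_of_not_frequencyGrowthExponent (h : ¬ FrequencyGrowthExponent) : HasClassLoop := by
  by_contra hW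
  apply h
  intro C v hrate hcont hmild hdiv hpol
  refine ⟨1, 0, one_pos, by norm_num, ?_⟩
  intro t₀ t _ ht c T hT hper hder hne
  exact (hW ⟨C, v, hrate, hcont, hmild, hdiv, hpol, t, ht, c, T, hT, hper, hder, hne⟩).elim

/-- **THE REFUTATION CRITERION: `¬ FrequencyGrowthExponent ↔ HasClassLoop`.**  Given the proved floor, the growth
exponent `κ < 3/2`, the constant `A` and the backward-persistence clause of the item are logically inert: the wall
is exactly «no e₃-poloidal Type-I Oseen-mild ancient profile carries a closed vortex line with vorticity». -/
theorem not_frequencyGrowthExponent_iff : ¬ FrequencyGrowthExponent ↔ HasClassLoop :=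
  ⟨hasClassLoop_of_not_frequencyGrowthExponent, frequencyGrowthExponent_false_of_hasClassLoop⟩

/-- The same criterion for the rev-1 aside `PeriodRatchet` (κ = 0, stmt-NavierStokesRegularity-22492): by the PROVED
`NoLoopsOfRatchet` a loop kills it, and without loops it is vacuous. -/
theorem not_periodRatchet_iff : ¬ PeriodRatchet ↔ HasClassLoop := by
  constructor
  · intro h
    by_contra hW
    apply h
    intro C v hrate hcont hmild hdiv hpol s₁ s₂ _ hs₂ γ₂ ℓ₂ hℓ₂ hγ₂ hper₂ hne₂ δ _
    exact (hW ⟨C, v, hrate, hcont, hmild, hdiv, hpol, s₂, hs₂, γ₂, ℓ₂, hℓ₂, hper₂, hγ₂, 0, hne₂⟩).elim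
  · rintro ⟨C, v, hrate, hcont, hmild, hdiv, hpol, t, ht, c, T, hloop⟩ hR
    obtain ⟨γ, hT, hγ, hper, hne⟩ := exists_rebased_of_isVortexLoop hloop
    exact hne (noLoopsOfRatchet_proof hR periodScalingBound_proof C v hrate hcont hmild hdiv hpol t ht γ T hT hγ hper)

/-- **The «certified weakening» is an equivalence**: given the proved floor, `FrequencyGrowthExponent` (∃ κ < 3/2) and
`PeriodRatchet` (κ = 0, `A = 1 + δ`) are both equivalent to «no loop in the class».  (Neither is claimed.) -/
theorem frequencyGrowthExponent_iff_periodRatchet : FrequencyGrowthExponent ↔ PeriodRatchet := by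
  rw [← not_iff_not, not_frequencyGrowthExponent_iff, not_periodRatchet_iff]

/-! ## The adversary's bar: a witness refutes the Liouville conjecture (L) -/

/-- **A loop-carrying profile is a counterexample to (L).**  Under the Liouville conjecture
`LiouvilleConjectureNS` of Koch–Nadirashvili–Seregin–Šverák every profile of the class vanishes identically
(`Theorems.typeIAncientMild_eq_zero_of_liouvilleConjectureNS` with the class bridge `isTypeIAncientMild_of_class`:
time shift, (L) makes slices constant, the Oseen gauge and the Type-I rate kill constants), and the zero slice has no
non-stationary vortex line (`curl 0 = 0`). [cite: KochNadirashviliSereginSverak2009, §1 conjecture (L) (arXiv:0709.3599); AlbrittonBarker2019, Thm 1.1 (arXiv:1811.00502)] -/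
theorem not_liouvilleConjectureNS_of_hasClassLoop (hW : HasClassLoop) :
    ¬ _root_.Summit.NavierStokesRegularity.NavierStokesRegularity.LiouvilleConjectureNS := by
  intro hL
  obtain ⟨C, v, hrate, hcont, hmild, hdiv, _, t, ht, c, T, _, _, _, s, hs⟩ := hW
  have hz : v t = fun _ => 0 :=
    funext fun x => Theorems.typeIAncientMild_eq_zero_of_liouvilleConjectureNS
      (fun u hu hm => hL u hu hm) (isTypeIAncientMild_of_class hrate hcont hmild hdiv) ht x
  exact hs (by rw [hz]; exact Literature.Analysis.FluidPDE.curl_fun_zero _)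

/-- **A refutation of the wall refutes (L)** (equivalently: (L) implies `FrequencyGrowthExponent`).  So `W FOUND`
would be a non-constant bounded ancient mild solution — by Albritton–Barker 2019, Thm 1.1, the profile of a Type-I
singularity of the three-dimensional Navier–Stokes equations. [cite: KochNadirashviliSereginSverak2009, §1 conjecture (L) (arXiv:0709.3599)] -/
theorem not_liouvilleConjectureNS_of_not_frequencyGrowthExponent (h : ¬ FrequencyGrowthExponent) :
    ¬ _root_.Summit.NavierStokesRegularity.NavierStokesRegularity.LiouvilleConjectureNS :=
  not_liouvilleConjectureNS_of_hasClassLoop (hasClassLoop_of_not_frequencyGrowthExponent h)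

/-! ## Planar peaks of the vertical velocity (the hot_loops form of `W`) -/

/-- The punctured horizontal plane through `y` accumulates at `y` (the points `y + ε e₀`). -/
theorem nhdsWithin_puncturedPlane_neBot (y : EuclideanSpace ℝ (Fin 3)) :
    (nhdsWithin y {y' : EuclideanSpace ℝ (Fin 3) | y' 2 = y 2 ∧ y' ≠ y}).NeBot := by
  rw [← mem_closure_iff_nhdsWithin_neBot, Metric.mem_closure_iff]
  intro ε hε
  refine ⟨y + (ε / 2) • EuclideanSpace.single (0 : Fin 3) (1 : ℝ), ⟨?_, ?_⟩, ?_⟩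
  · simp
  · intro h
    have h0 := congrFun (congrArg (fun z : EuclideanSpace ℝ (Fin 3) => (z : Fin 3 → ℝ)) h) 0
    simp at h0
    exact hε.ne' h0
  · rw [dist_eq_norm, sub_add_cancel_left, norm_neg, norm_smul, PiLp.norm_single, norm_one, mul_one,
      Real.norm_of_nonneg (by linarith)]
    linarith

/-- **`W′ → ¬ FrequencyGrowthExponent`.**  Modulo the wall a strict local planar extremum of `σ·v₃` anywhere forces
`v ≡ 0` on the past (`zero_of_strictPlanarExtremum`, landed: islands persist to nearby planes, each yields a loop or
an irrotational disc, the wall kills loops, null discs spread); but `v(s,·) = 0` has no strict planar extremum, the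
punctured plane being non-trivial as a filter. -/
theorem frequencyGrowthExponent_false_of_hasClassPlanarPeak (hW : HasClassPlanarPeak) : ¬ FrequencyGrowthExponent := by
  intro hG
  obtain ⟨C, v, hrate, hcont, hmild, hdiv, hpol, s, σ, y, hs, hσ, hpeak⟩ := hW
  have hz : ∀ x, v s x = 0 :=
    fun x => zero_of_strictPlanarExtremum hG C v hrate hcont hmild hdiv hpol s σ y hs hσ hpeak s hs x
  have hfalse : ∀ᶠ _ in nhdsWithin y {y' : EuclideanSpace ℝ (Fin 3) | y' 2 = y 2 ∧ y' ≠ y}, False :=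
    hpeak.mono fun y' hy' => by simp [hz y', hz y] at hy'
  haveI := nhdsWithin_puncturedPlane_neBot y
  exact (Filter.eventually_false_iff_eq_bot.1 hfalse ▸ this).ne rfl

/-- Through the criterion, a planar-peak profile forces SOME loop-carrying profile of the class (not necessarily the
same one: the hot_loops chain is run modulo the wall). -/
theorem hasClassLoop_of_hasClassPlanarPeak (hW : HasClassPlanarPeak) : HasClassLoop :=
  hasClassLoop_of_not_frequencyGrowthExponent (frequencyGrowthExponent_false_of_hasClassPlanarPeak hW)

end Summit.NavierStokesRegularity.NavierStokesRegularity.Theorems.FrequencyGrowthExponent.Negative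

end
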